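import Summits.BirchSwinnertonDyer.BirchSwinnertonDyer.Theorems.GenusKolyvaginAtTwoPowDvdShaCardAtTwoRTKummerLagrangianInv
import Summits.BirchSwinnertonDyer.BirchSwinnertonDyer.Theorems.GenusKolyvaginAtTwoPowDvdShaCardAtTwoRTInvariantLostBit
import Literature.NumberTheory.EllipticCurves.CasselsTateLocalCupSymmetry
import HarnessLib

/-!
# Route `GenusKolyvaginAtTwo`, crux L_T `PowDvdShaCardAtTwoRT` (stmt-BirchSwinnertonDyer-23242), LINE 18 stub KS, the DROPS, input `hrec` —
# THE LOCAL EIGEN-DUALITY LAW AT A DEEP INERT KOLYVAGIN PLACE AT `p = 2`: the order of `inv_v(X ∪ₑ Y)` for two same-sign local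
# classes, one UNRAMIFIED, the other read MODULO the Kummer condition, is `2^(α + β − (M+1))` — from a displayed `τ`-structure

Seat `bsd-line-gk2-p3` g23 (PROVER seat 3/3, cell `bsd-f1-sign2`), `--supports stmt-BirchSwinnertonDyer-23242` (helper; closes nothing).
THEOREMS ONLY over any number field `K`, any elliptic `W/K`, level `2^M`, any finite place `v`, any family `inv` injective at `v`
(no definition, no named fact, no `sorry`).  BSD is NOT proved by any of this; neither is the crux nor any stub.

WHY.  Kolyvagin's two-term identity (Math. Ann. 291 (1991) Thm. 2.1; the input `hrec` of gk2-p2's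
`PlusDescent.weakSwapOracle_of_twoPrimeReciprocity`) compares the ORDERS of the two surviving local terms `inv_{λ′}(loc c(nℓ′) ∪ₑ loc c(nℓ₀))`,
`inv_{λ₀}(…)` of a Poitou–Tate sum over the Heegner field.  At each of the two deep inert Kolyvagin places ONE class is unramified (in the
Kummer condition `𝓛_v`) and the other is an own class, of which only the order MODULO `𝓛_v` is known (route item Q2
`KolyvaginRelationAtTwo`: «Selmer at `v` ⟺ zero at `v`» for its multiples); both are `τ`-eigen of the SAME sign.  This file turns the
`τ`-STRUCTURE of `H = H¹(K_v, E[2^M])` — DISPLAYED as hypotheses, to be discharged from the tree's `conjActPlace` /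
`isConjCompatible_canonical` / Howard's evaluation isomorphisms in a sequel — into the exact order law, by the invariant lost-bit law
(`…RTInvariantLostBit`) and the Lagrangian property of `𝓛_v` (`…RTKummerLagrangianInv`):
displayed are an involution `σ` of `H` preserving `b = inv_v(· ∪ₑ ·)` (`b(σX, σY) = b(X, Y)`), and an additive, injective,
`(t, σ)`-equivariant parametrisation `unr : T → H` of `𝓛_v` by a free rank-one `ℤ/2^M[t]`-module `T` on `P₁` (in the sequel:
`T = E[2^M]`, `t = c₀`, `P₁` the regular generator of route item Q1 on `Δ < 0`, `unr Q` = the unramified class with Frobenius value `Q`).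
* §0 `invWeilPairing_comm` — `inv_v(X ∪ₑ Y) = inv_v(Y ∪ₑ X)` (graded commutativity for the skew Weil pairing, tree
  `cupProduct_comm_of_skew`); `weilPairingHom_skew`.
* §1 `pow_smul_invWeilPairing_unr_eq_zero_iff_mem` — for a `σ`-eigenclass `X`: `2^j • b(unr P₁, X) = 0 ⟺ 2^j • X ∈ 𝓛_v` (isotropy +
  `𝓛_v^⊥ = 𝓛_v`); `addOrderOf_invWeilPairing_unr_basis_eq` — hence `addOrderOf b(unr P₁, X) = 2^β` when «`2^j X ∈ 𝓛_v ⟺ β ≤ j`»;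
  `addOrderOf_eq_two_pow_of_forall_iff`, `addOrderOf_unr_eq`, `eigen_of_unr_eigen`.
* §2 **`addOrderOf_invWeilPairing_unr_eq_of_same_sign`** — for `tQ = εQ` of order `2^α` and `σX = εX` with «`2^j X ∈ 𝓛_v ⟺ β ≤ j`»:
  `addOrderOf (inv_v(unr Q ∪ₑ X)) = 2^(α + β − (M+1))`; the flipped form `addOrderOf_invWeilPairing_unr_right_eq_of_same_sign`
  (`inv_v(X ∪ₑ unr Q)`); thresholds `pow_smul_invWeilPairing_unr_eq_zero_iff`; and `invWeilPairing_unr_eq_zero_of_opposite_signs`.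
* §3 `exponent_eq_of_add_eq_zero` — the comparison step of the two-term identity: two values of `ℤ/2^M` with `r′ + r₀ = 0` and orders
  `2^(a − (M+1))`, `2^(b − (M+1))`, `a ≥ M + 2` ⟹ `a = b`.
HONEST FRAMING: pure bookkeeping over the two cited files; the arithmetic (who is `σ`, who is `unr`) is the sequel's.  Closes nothing.

References: [Kolyvagin1991MathAnn] Thm. 2.1; [McCallumLMS1991] §4 Prop. 4.4, §5 Lemma 5.3 and (13); [MilneADT2006] I Cor. 2.3, Cor. 3.4;
[Howard2004HeegnerKolyvagin] Prop. 1.1.7, Lemma 1.5.3; [NeukirchSchmidtWingberg2008] I Prop. 1.4.4.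
-/

set_option autoImplicit false

noncomputable section

open scoped Classical

open CategoryTheory Field NumberField IsDedekindDomain Function
open Literature.NumberTheory.EllipticCurves
open Literature.NumberTheory.GaloisRepresentations
open Literature.NumberTheory.GaloisCohomology
open Summit.BirchSwinnertonDyer.Rank1Residual.X11b.KummerPT
open Summit.BirchSwinnertonDyer.Rank1Residual.X11b.FiniteDuality
open Summit.BirchSwinnertonDyer.Rank1Residual.X11b.Relaxation
open scoped ContRepresentation

-- the Theorems namespace of this sub repeats the summit name by design (D-0017 nested layout)
set_option linter.dupNamespace false

namespace Summit.BirchSwinnertonDyer.BirchSwinnertonDyer.Theorems.GenusExact.PlusDescent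

variable {K : Type} [Field K] [NumberField K] (W : WeierstrassCurve K) [W.IsElliptic] (M : ℕ)
variable (e : W.geomTorsion ((2 ^ M : ℕ) : ℤ) → W.geomTorsion ((2 ^ M : ℕ) : ℤ) → AlgebraicClosure K)
  (hμ : ∀ S T, e S T ^ (2 ^ M) = 1)
  (hadd₁ : ∀ S₁ S₂ T, e (S₁ + S₂) T = e S₁ T * e S₂ T)
  (hadd₂ : ∀ S T₁ T₂, e S (T₁ + T₂) = e S T₁ * e S T₂)
  (hgal : ∀ (γ : absoluteGaloisGroup K) (S T : W.geomTorsion ((2 ^ M : ℕ) : ℤ)), γ • e S T = e (γ • S) (γ • T))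
  (halt : ∀ T, e T T = 1) (hnondeg : ∀ T, (∀ S, e S T = 1) → T = 0)
  (v : HeightOneSpectrum (𝓞 K)) (inv : LocalInvariants K (2 ^ M)) (hinv : Injective (inv (Sum.inr v)))

/-! ## §0 Symmetry of `inv_v(· ∪ₑ ·)` -/

omit [NumberField K] [W.IsElliptic] in
include halt in
/-- An alternating biadditive pairing is skew: `e(S, T) = e(T, S)⁻¹`, additively in `μ_{2^M}`. [folklore] -/
theorem weilPairingHom_skew (S T : W.geomTorsion ((2 ^ M : ℕ) : ℤ)) :
    weilPairingHom W (2 ^ M) e hμ hadd₁ hadd₂ S T = -weilPairingHom W (2 ^ M) e hμ hadd₁ hadd₂ T S := by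
  have h := weilPairingHom_self W (2 ^ M) e hμ hadd₁ hadd₂ halt (S + T)
  simp only [map_add, AddMonoidHom.add_apply, weilPairingHom_self W (2 ^ M) e hμ hadd₁ hadd₂ halt, zero_add, add_zero] at h
  rw [eq_neg_iff_add_eq_zero]
  first
  | exact h
  | (rw [add_comm]; exact h)

omit [W.IsElliptic] in
include halt in
/-- **`inv_v(X ∪ₑ Y) = inv_v(Y ∪ₑ X)`**: the local Weil cup-product pairing on `H¹(K_v, E[2^M])` is SYMMETRIC (graded commutativity in
bidegree `(1,1)` for the skew pairing `e`, tree `cupProduct_comm_of_skew`). [cite: NeukirchSchmidtWingberg2008, I §4 Prop. 1.4.4] -/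
theorem invWeilPairing_comm (X Y : galoisCohomology ((W.torsionGaloisModule ((2 ^ M : ℕ) : ℤ)).toLocal (Sum.inr v)) 1) :
    invWeilPairing W (2 ^ M) e hμ hadd₁ hadd₂ hgal inv (Sum.inr v) X Y =
      invWeilPairing W (2 ^ M) e hμ hadd₁ hadd₂ hgal inv (Sum.inr v) Y X := by
  -- cup products need `LocallyCompactSpace Γ_{K_v}` (compactness of the absolute Galois group, a `haveI` as in the tree's files)
  haveI := absoluteGaloisGroup_compactSpace (Place.Completion (Sum.inr v : Place K))
  rw [invWeilPairing_apply, invWeilPairing_apply,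
    cupProduct_comm_of_skew (weilContPairingLocal W (2 ^ M) e hμ hadd₁ hadd₂ hgal (Sum.inr v))
      (fun x y ↦ weilPairingHom_skew W M e hμ hadd₁ hadd₂ halt x y) X Y]

/-! ## §1 The basis functional reads the order modulo the Kummer condition -/

section Structure

variable {T : Type*} [AddCommGroup T] (t : T →+ T) (ht : ∀ Q, t (t Q) = Q)
  (σ : galoisCohomology ((W.torsionGaloisModule ((2 ^ M : ℕ) : ℤ)).toLocal (Sum.inr v)) 1 →+
    galoisCohomology ((W.torsionGaloisModule ((2 ^ M : ℕ) : ℤ)).toLocal (Sum.inr v)) 1)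
  (hσ : ∀ X, σ (σ X) = X)
  (hσb : ∀ X Y, invWeilPairing W (2 ^ M) e hμ hadd₁ hadd₂ hgal inv (Sum.inr v) (σ X) (σ Y) =
    invWeilPairing W (2 ^ M) e hμ hadd₁ hadd₂ hgal inv (Sum.inr v) X Y)
  (unr : T →+ galoisCohomology ((W.torsionGaloisModule ((2 ^ M : ℕ) : ℤ)).toLocal (Sum.inr v)) 1)
  (hunr : ∀ Q, unr (t Q) = σ (unr Q))
  (hunrL : ∀ Q, unr Q ∈ W.kummerSelmerStructure ((2 ^ M : ℕ) : ℤ) (Sum.inr v))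
  (hLunr : ∀ Y ∈ W.kummerSelmerStructure ((2 ^ M : ℕ) : ℤ) (Sum.inr v), ∃ Q, unr Q = Y)
  (hunr0 : Injective unr)
  (P₁ : T)
  (hspan : ∀ Q : T, ∃ a b : ℤ, Q = a • P₁ + b • t P₁)
  (hfree : ∀ a b : ℤ, a • P₁ + b • t P₁ = 0 → (2 ^ M : ℤ) ∣ a ∧ (2 ^ M : ℤ) ∣ b)
  (htor : (2 ^ M : ℤ) • P₁ = 0)

/-- A `2`-primary element whose multiples `2^j • z` vanish exactly for `j ≥ β` has order `2^β`. [folklore] -/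
theorem addOrderOf_eq_two_pow_of_forall_iff {G : Type*} [AddCommGroup G] {z : G} {β : ℕ}
    (h : ∀ j : ℕ, (2 ^ j) • z = 0 ↔ β ≤ j) : addOrderOf z = 2 ^ β := by
  have hβ : addOrderOf z ∣ 2 ^ β := addOrderOf_dvd_iff_nsmul_eq_zero.mpr ((h β).mpr le_rfl)
  obtain ⟨i, hi, heq⟩ := (Nat.dvd_prime_pow Nat.prime_two).mp hβ
  have hiz : (2 ^ i) • z = 0 := by rw [← heq]; exact addOrderOf_nsmul_eq_zero z
  have hβi : β ≤ i := (h i).mp hiz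
  rw [heq, le_antisymm hi hβi]

omit [W.IsElliptic] in
include hunr0 in
/-- The parametrisation preserves orders: `addOrderOf (unr Q) = addOrderOf Q`. [folklore] -/
theorem addOrderOf_unr_eq (Q : T) : addOrderOf (unr Q) = addOrderOf Q :=
  addOrderOf_injective unr hunr0 Q

omit [W.IsElliptic] in
include hunr hunr0 in
/-- Eigen-ness transfers along `unr`: `σ(unr Q) = ε·unr Q ⟹ tQ = εQ` (`ε = ±1`). [folklore] -/
theorem eigen_of_unr_eigen {Q : T} :
    (σ (unr Q) = unr Q → t Q = Q) ∧ (σ (unr Q) = -unr Q → t Q = -Q) := by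
  constructor
  · intro h; apply hunr0; rw [hunr, h]
  · intro h; apply hunr0; rw [hunr, h, map_neg]

omit [W.IsElliptic] in
include hσ hσb in
/-- Moving `σ` across the invariant pairing `b = inv_v(· ∪ₑ ·)`: `b(σX, Y) = b(X, σY)`. [folklore] -/
theorem invWeilPairing_sigma_left (X Y : galoisCohomology ((W.torsionGaloisModule ((2 ^ M : ℕ) : ℤ)).toLocal (Sum.inr v)) 1) :
    invWeilPairing W (2 ^ M) e hμ hadd₁ hadd₂ hgal inv (Sum.inr v) (σ X) Y =
      invWeilPairing W (2 ^ M) e hμ hadd₁ hadd₂ hgal inv (Sum.inr v) X (σ Y) := by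
  have h := hσb X (σ Y)
  rwa [hσ] at h

include halt hnondeg hinv hσ hσb hunr hunrL hLunr hspan in
/-- **The basis functional reads the order MODULO the Kummer condition.** For a `σ`-eigenclass `X` (`σX = ±X`) and every `j`:
`2^j • inv_v(unr P₁ ∪ₑ X) = 0 ⟺ 2^j • X ∈ 𝓛_v`.  (⟸: isotropy of `𝓛_v`; ⟹: then also `inv_v(unr(tP₁) ∪ₑ 2^jX) = ±… = 0`, so `2^jX` is
orthogonal to `unr(T) = 𝓛_v`, i.e. lies in `𝓛_v^⊥ = 𝓛_v`.) [cite: MilneADT2006, Ch. I, Cor. 3.4] [cite: McCallumLMS1991, §5 Lemma 5.3] -/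
theorem pow_smul_invWeilPairing_unr_eq_zero_iff_mem (hM : M ≠ 0)
    {X : galoisCohomology ((W.torsionGaloisModule ((2 ^ M : ℕ) : ℤ)).toLocal (Sum.inr v)) 1} (hX : σ X = X ∨ σ X = -X) (j : ℕ) :
    (2 ^ j) • invWeilPairing W (2 ^ M) e hμ hadd₁ hadd₂ hgal inv (Sum.inr v) (unr P₁) X = 0 ↔
      (2 ^ j) • X ∈ W.kummerSelmerStructure ((2 ^ M : ℕ) : ℤ) (Sum.inr v) := by
  set b := invWeilPairing W (2 ^ M) e hμ hadd₁ hadd₂ hgal inv (Sum.inr v) with hb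
  constructor
  · intro h0
    -- `b (unr P₁) (2^j X) = 0` and `b (unr (t P₁)) (2^j X) = 0`
    have h1 : b (unr P₁) ((2 ^ j) • X) = 0 := by rw [map_nsmul, h0]
    have h2 : b (unr (t P₁)) ((2 ^ j) • X) = 0 := by
      rw [hunr, invWeilPairing_sigma_left W M e hμ hadd₁ hadd₂ hgal v inv σ hσ hσb, map_nsmul]
      rcases hX with hX | hX
      · rw [hX]; exact h1
      · rw [hX, smul_neg, map_neg, neg_eq_zero]; exact h1
    -- hence orthogonal to all of `unr T = 𝓛_v`
    have h3 : ∀ Q : T, b (unr Q) ((2 ^ j) • X) = 0 := fun Q ↦ by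
      obtain ⟨a, c, rfl⟩ := hspan Q
      rw [map_add, map_zsmul, map_zsmul, map_add, map_zsmul, map_zsmul, AddMonoidHom.add_apply,
        AddMonoidHom.zsmul_apply, AddMonoidHom.zsmul_apply, h1, h2, zsmul_zero, zsmul_zero, add_zero]
    have h4 : (2 ^ j) • X ∈ annRight b (W.kummerSelmerStructure ((2 ^ M : ℕ) : ℤ) (Sum.inr v)) := by
      rw [mem_annRight_iff]
      intro Y hY
      obtain ⟨Q, rfl⟩ := hLunr Y hY
      exact h3 Q
    rwa [hb, KummerLagrangian.annRight_invWeilPairing_kummer_eq' W 2 M e hμ hadd₁ hadd₂ hgal halt hnondeg v hM hinv] at h4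
  · intro hmem
    rw [← map_nsmul]
    exact invWeilPairing_eq_zero_of_mem W (2 ^ M) e hμ hadd₁ hadd₂ hgal halt inv (Sum.inr v) (hunrL P₁) hmem

include halt hnondeg hinv hσ hσb hunr hunrL hLunr hspan in
/-- Hence, for a `σ`-eigenclass `X` whose multiples lie in `𝓛_v` exactly from `2^β` on: **`addOrderOf (inv_v(unr P₁ ∪ₑ X)) = 2^β`** —
the basis functional has the order of `X` MODULO the Kummer condition (at an own prime of a Kolyvagin class: the order clause of route
item Q2). [cite: McCallumLMS1991, §4 Prop. 4.4, §5 Lemma 5.3] -/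
theorem addOrderOf_invWeilPairing_unr_basis_eq (hM : M ≠ 0)
    {X : galoisCohomology ((W.torsionGaloisModule ((2 ^ M : ℕ) : ℤ)).toLocal (Sum.inr v)) 1} (hX : σ X = X ∨ σ X = -X)
    {β : ℕ} (hβ : ∀ j : ℕ, (2 ^ j) • X ∈ W.kummerSelmerStructure ((2 ^ M : ℕ) : ℤ) (Sum.inr v) ↔ β ≤ j) :
    addOrderOf (invWeilPairing W (2 ^ M) e hμ hadd₁ hadd₂ hgal inv (Sum.inr v) (unr P₁) X) = 2 ^ β :=
  addOrderOf_eq_two_pow_of_forall_iff fun j ↦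
    (pow_smul_invWeilPairing_unr_eq_zero_iff_mem W M e hμ hadd₁ hadd₂ hgal halt hnondeg v inv hinv t σ hσ hσb unr hunr hunrL hLunr
      P₁ hspan hM hX j).trans (hβ j)

/-! ## §2 The order law -/

include halt hnondeg hinv ht hσ hσb hunr hunrL hLunr hspan hfree htor in
/-- **THE LOCAL EIGEN-DUALITY LAW (same sign).**  `tQ = εQ` with `addOrderOf Q = 2^α`, `σX = εX` with «`2^j X ∈ 𝓛_v ⟺ β ≤ j`»
(`ε = ±1`, the SAME for both): **`addOrderOf (inv_v(unr Q ∪ₑ X)) = 2^(α + β − (M + 1))`** — exactly one bit is lost.  This is the order of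
each surviving term of Kolyvagin's two-term reciprocity at `p = 2` over the Heegner field (unramified Kolyvagin class against an own
class of the same depth parity). [cite: Kolyvagin1991MathAnn, Thm. 2.1] [cite: McCallumLMS1991, §5 Lemma 5.3 and (13)] -/
theorem addOrderOf_invWeilPairing_unr_eq_of_same_sign (hM : M ≠ 0) {Q : T}
    {X : galoisCohomology ((W.torsionGaloisModule ((2 ^ M : ℕ) : ℤ)).toLocal (Sum.inr v)) 1}
    (hQX : (t Q = Q ∧ σ X = X) ∨ (t Q = -Q ∧ σ X = -X)) {α β : ℕ} (hα : addOrderOf Q = 2 ^ α)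
    (hβ : ∀ j : ℕ, (2 ^ j) • X ∈ W.kummerSelmerStructure ((2 ^ M : ℕ) : ℤ) (Sum.inr v) ↔ β ≤ j) :
    addOrderOf (invWeilPairing W (2 ^ M) e hμ hadd₁ hadd₂ hgal inv (Sum.inr v) (unr Q) X) = 2 ^ (α + β - (M + 1)) := by
  set b := invWeilPairing W (2 ^ M) e hμ hadd₁ hadd₂ hgal inv (Sum.inr v) with hb
  have hX : σ X = X ∨ σ X = -X := hQX.elim (fun h ↦ Or.inl h.2) (fun h ↦ Or.inr h.2)
  have hinv' : ∀ (x : T) (y : galoisCohomology ((W.torsionGaloisModule ((2 ^ M : ℕ) : ℤ)).toLocal (Sum.inr v)) 1),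
      (b.comp unr) (t x) (σ y) = (b.comp unr) x y := fun x y ↦ by
    rw [AddMonoidHom.comp_apply, AddMonoidHom.comp_apply, hunr, hσb]
  have hPy : addOrderOf ((b.comp unr) P₁ X) = 2 ^ β := by
    rw [AddMonoidHom.comp_apply]
    exact addOrderOf_invWeilPairing_unr_basis_eq W M e hμ hadd₁ hadd₂ hgal halt hnondeg v inv hinv t σ hσ hσb unr hunr hunrL hLunr
      P₁ hspan hM hX hβ
  have key := invariantLostBit_addOrderOf_pairing_same_sign_of_basis t ht σ hσ (b.comp unr) hinv' P₁ hspan hfree htor hQX hα hPy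
  rwa [AddMonoidHom.comp_apply] at key

include halt hnondeg hinv ht hσ hσb hunr hunrL hLunr hspan hfree htor in
/-- **The order law, flipped** (`X` in the first slot, by the symmetry of `inv_v(· ∪ₑ ·)`):
`addOrderOf (inv_v(X ∪ₑ unr Q)) = 2^(α + β − (M + 1))` — the shape of the term at the NEW prime `λ′` of Kolyvagin's swap, where the own
class `loc c(nℓ′)` sits on the left. [cite: Kolyvagin1991MathAnn, Thm. 2.1] -/
theorem addOrderOf_invWeilPairing_unr_right_eq_of_same_sign (hM : M ≠ 0) {Q : T}
    {X : galoisCohomology ((W.torsionGaloisModule ((2 ^ M : ℕ) : ℤ)).toLocal (Sum.inr v)) 1}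
    (hQX : (t Q = Q ∧ σ X = X) ∨ (t Q = -Q ∧ σ X = -X)) {α β : ℕ} (hα : addOrderOf Q = 2 ^ α)
    (hβ : ∀ j : ℕ, (2 ^ j) • X ∈ W.kummerSelmerStructure ((2 ^ M : ℕ) : ℤ) (Sum.inr v) ↔ β ≤ j) :
    addOrderOf (invWeilPairing W (2 ^ M) e hμ hadd₁ hadd₂ hgal inv (Sum.inr v) X (unr Q)) = 2 ^ (α + β - (M + 1)) := by
  rw [invWeilPairing_comm W M e hμ hadd₁ hadd₂ hgal halt v inv X (unr Q)]
  exact addOrderOf_invWeilPairing_unr_eq_of_same_sign W M e hμ hadd₁ hadd₂ hgal halt hnondeg v inv hinv t ht σ hσ hσb unr hunr hunrL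
    hLunr P₁ hspan hfree htor hM hQX hα hβ

include halt hnondeg hinv ht hσ hσb hunr hunrL hLunr hspan hfree htor in
/-- **Vanishing threshold**: `2^j • inv_v(unr Q ∪ₑ X) = 0 ⟺ α + β ≤ M + 1 + j`; at `j = 0` this is the informativeness guard of
Kolyvagin's identity (`α + β ≥ M + 2 ⟺` the term is non-zero). [cite: Kolyvagin1991MathAnn, Thm. 2.1] -/
theorem pow_smul_invWeilPairing_unr_eq_zero_iff (hM : M ≠ 0) {Q : T}
    {X : galoisCohomology ((W.torsionGaloisModule ((2 ^ M : ℕ) : ℤ)).toLocal (Sum.inr v)) 1}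
    (hQX : (t Q = Q ∧ σ X = X) ∨ (t Q = -Q ∧ σ X = -X)) {α β : ℕ} (hα : addOrderOf Q = 2 ^ α)
    (hβ : ∀ j : ℕ, (2 ^ j) • X ∈ W.kummerSelmerStructure ((2 ^ M : ℕ) : ℤ) (Sum.inr v) ↔ β ≤ j) (j : ℕ) :
    (2 ^ j) • invWeilPairing W (2 ^ M) e hμ hadd₁ hadd₂ hgal inv (Sum.inr v) (unr Q) X = 0 ↔ α + β ≤ M + 1 + j := by
  rw [← addOrderOf_dvd_iff_nsmul_eq_zero,
    addOrderOf_invWeilPairing_unr_eq_of_same_sign W M e hμ hadd₁ hadd₂ hgal halt hnondeg v inv hinv t ht σ hσ hσb unr hunr hunrL hLunr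
      P₁ hspan hfree htor hM hQX hα hβ, Nat.pow_dvd_pow_iff_le_right one_lt_two]
  omega

omit [W.IsElliptic] in
include ht hσ hσb hunr hspan hfree htor in
/-- **Opposite signs are orthogonal**: `tQ = Q`, `σX = −X` (or `tQ = −Q`, `σX = X`) ⟹ `inv_v(unr Q ∪ₑ X) = 0` — Kolyvagin classes of
opposite depth parity pair trivially at a deep inert Kolyvagin place. [cite: McCallumLMS1991, §5 Lemma 5.3]
[cite: Howard2004HeegnerKolyvagin, Lemma 1.5.3] -/
theorem invWeilPairing_unr_eq_zero_of_opposite_signs {Q : T}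
    {X : galoisCohomology ((W.torsionGaloisModule ((2 ^ M : ℕ) : ℤ)).toLocal (Sum.inr v)) 1}
    (hQX : (t Q = Q ∧ σ X = -X) ∨ (t Q = -Q ∧ σ X = X)) :
    invWeilPairing W (2 ^ M) e hμ hadd₁ hadd₂ hgal inv (Sum.inr v) (unr Q) X = 0 := by
  set b := invWeilPairing W (2 ^ M) e hμ hadd₁ hadd₂ hgal inv (Sum.inr v) with hb
  have hinv' : ∀ (x : T) (y : galoisCohomology ((W.torsionGaloisModule ((2 ^ M : ℕ) : ℤ)).toLocal (Sum.inr v)) 1),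
      (b.comp unr) (t x) (σ y) = (b.comp unr) x y := fun x y ↦ by
    rw [AddMonoidHom.comp_apply, AddMonoidHom.comp_apply, hunr, hσb]
  have key := pairing_eq_zero_of_opposite_signs t ht σ hσ (b.comp unr) hinv' P₁ hspan hfree htor
  rcases hQX with ⟨hQ, hX⟩ | ⟨hQ, hX⟩
  · have := key.1 Q X hQ hX; rwa [AddMonoidHom.comp_apply] at this
  · have := key.2 Q X hQ hX; rwa [AddMonoidHom.comp_apply] at this

end Structure

/-! ## §3 The comparison step of the two-term identity -/

/-- **Two local terms that sum to zero have equal exponents** (in the informative range): if `r + r′ = 0` in an additive group,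
`addOrderOf r = 2^(a − (M+1))`, `addOrderOf r′ = 2^(b − (M+1))` and `M + 2 ≤ a`, then `a = b`.  This is how Kolyvagin's reciprocity
law `Σ_v inv_v = 0`, reduced to its two surviving terms at `λ′` and `λ₀`, becomes the identity `d′ + d″ = d₀ + d₀′` of local
divisibilities (`α = M − d`). [cite: Kolyvagin1991MathAnn, Thm. 2.1] [cite: McCallumLMS1991, §5 (13)] -/
theorem exponent_eq_of_add_eq_zero {R : Type*} [AddCommGroup R] {r r' : R} {a b M : ℕ} (hsum : r + r' = 0)
    (hr : addOrderOf r = 2 ^ (a - (M + 1))) (hr' : addOrderOf r' = 2 ^ (b - (M + 1))) (ha : M + 2 ≤ a) : a = b := by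
  have hneg : r = -r' := eq_neg_of_add_eq_zero_left hsum
  have hord : addOrderOf r = addOrderOf r' := by rw [hneg, addOrderOf_neg]
  rw [hr, hr'] at hord
  have := eq_of_two_pow_eq_two_pow hord
  omega

end Summit.BirchSwinnertonDyer.BirchSwinnertonDyer.Theorems.GenusExact.PlusDescent

end
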